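import Summits.ResolutionOfSingularities.ResolutionOfSingularities.Theorems.NearPointCutClasses
import HarnessLib

/-!
# NearPointCutKernels — §5 of the decomp-res node «NearPointCut» v3 (lens-4 g14, sha256 f6cc5d14e40b8f11;
critic rows 81/92/95 CLEARED)

Tree file 3/4, route-independent: the PROVED kernels — (β1) `quasiIsolated_of_keyTheorem640` (engine `KeyTheorem640_char` BY
NAME), (α) `directrixOne_of_corollary637` (engine `Corollary637_char` + COSTUME adapter / restart / isolation ports),
`nearLine_iff_nonQuasiIsolated`, `pieces_of_singularSurface`, the ONE certified EQUIV `singularSurface_iff_pieces`,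
`singularSurface_of_g13` / `singularSurface_of_g13'`, and the definitional `singularSurface_iff_noTower` — VERBATIM.
(Sources: CossartJannsenSaito2020 Cor. 6.37, Thm. 6.40, Thm. 3.14.)
-/

open CategoryTheory AlgebraicGeometry
open Literature.RingTheory.HilbertSamuel
open Literature.AlgebraicGeometry.Resolution
open Literature.AlgebraicGeometry.CossartJannsenSaito2020
open Summit.ResolutionOfSingularities.ResolutionOfSingularities.Theorems
open WeakOrderReduction ForcedTowerClasses DivergentTowerClasses MonomialTowerClasses
open HugDimensionClasses HugDimensionKernels SurfaceShadowClasses SurfaceShadowKernels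

namespace Summit.ResolutionOfSingularities.ResolutionOfSingularities.Theorems.NearPointCut

/-- The target IS `NoTower n SingularClass` (definitional). [folklore] -/
theorem singularSurface_iff_noTower {n : ℕ} : SingularSurfaceHuggingTowersTerminate n ↔ NoTower n SingularClass :=
  Iff.rfl

/-! ## §5 Kernels (PROVED) -/

/-- **KERNEL — (β1) THE QUASI-ISOLATED COLUMN IS DECIDED by CJS Theorem 6.40, consumed BY NAME** (typed tree
fact `KeyTheorem640_char`; the length-one chain adapter `HSRealisation.isChain` is proved above). [cite:
CossartJannsenSaito2020, Thm. 6.40, Thm. 13.7, Thm. 14.4] [folklore] -/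
theorem quasiIsolated_of_keyTheorem640 (h640 : KeyTheorem640_char.{0}) (n : ℕ) :
    QuasiIsolatedTowersTerminate n := by
  rintro p hp k _ _ T g - - - ⟨-, R, a, hst, h2, hq⟩
  exact h640 (R.S.drop a) 2 (fun _ => 1) (fun i => R.y (a + unitStart (fun _ => 1) i)) (R.setting a)
    (R.charHyp a) (R.isChain hst h2) (fun i => hq _ (Nat.le_add_right _ _))

/-- **KERNEL — (α) THE DIRECTRIX-LINE COLUMN IS DECIDED by CJS Corollary 6.37, consumed BY NAME** (typed tree
fact `Corollary637_char`), modulo the COSTUME adapter `DirOneAdapter` and the COSTUME ports `Restart` /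
`IsolationPort` (v3, ledger-free): RESTART at the stable `e ≡ 1` stage (local, stable and `e ≡ 1` from 0), take
isolation at stage 0 of the restarted realisation from `IsolationPort`, apply Cor. 6.37 to the fundamental sequence
of `DirOneAdapter`. (Sources: CossartJannsenSaito2020, Cor. 6.37, Thm. 10.2.) -/
theorem directrixOne_of_corollary637 {n : ℕ} (h637 : Corollary637_char.{0}) (hA : DirOneAdapter)
    (hRs : Restart) (hI : IsolationPort n) : DirectrixOneTowersTerminate n := by
  rintro p hp k _ _ T g hB hD hE ⟨hS, R, b, hst, h1⟩
  obtain ⟨R', -, hloc, hH, he⟩ := hRs T R b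
  have hst' : R'.StableFrom 0 := fun i _ => by
    rw [hH, hH]
    exact hst (b + i) (Nat.le_add_right b i)
  have h1' : R'.DirOneFrom 0 := fun i _ => by
    rw [he]
    exact h1 (b + i) (Nat.le_add_right b i)
  have hiso : R'.Isolated 0 := hI p hp k T g hB hD hE hS R' hloc hst' h1' 0
  have hFS := hA T R' 0 hst' h1'
  have h := (h637 (R'.S.drop 0) 2 (R'.y 0) ⊤ (R'.setting 0) (R'.charHyp 0) hFS hiso (h1' 0 le_rfl)).1
  exact lt_irrefl _ h

/-- **KERNEL — THE RESIDUAL'S NORMAL FORM IS EXACT modulo the ledger**: «quasi-isolation fails infinitely often» =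
«near lines infinitely often». [folklore] -/
theorem nearLine_iff_nonQuasiIsolated {n : ℕ} (hL : LineagePort n) :
    NearLineTowersTerminate n ↔ NonQuasiIsolatedTowersTerminate n := by
  constructor
  · rintro h p hp k _ _ T g hB hD hE ⟨hS, R, a, hst, h2, hnq⟩
    obtain ⟨L⟩ := hL p hp k T g hB hD hE hS R a hst
    exact h p hp k T g hB hD hE ⟨hS, R, a, hst, h2, L.nearLineRecurrent_of_nonQI hnq⟩
  · rintro h p hp k _ _ T g hB hD hE ⟨hS, R, a, hst, h2, hnl⟩
    obtain ⟨L⟩ := hL p hp k T g hB hD hE hS R a hst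
    exact h p hp k T g hB hD hE ⟨hS, R, a, hst, h2, L.nonQI_of_nearLineRecurrent hnl⟩

/-- Necessity, PORT-FREE: the target implies every piece (each piece is a sub-class). [folklore] -/
theorem pieces_of_singularSurface {n : ℕ} (h : SingularSurfaceHuggingTowersTerminate n) :
    DirectrixOneTowersTerminate n ∧ QuasiIsolatedTowersTerminate n ∧ NearLineTowersTerminate n ∧
      NonQuasiIsolatedTowersTerminate n :=
  ⟨noTower_mono (fun _ h' => h'.1) h, noTower_mono (fun _ h' => h'.1) h, noTower_mono (fun _ h' => h'.1) h,
    noTower_mono (fun _ h' => h'.1) h⟩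

/-- **KERNEL — THE EXACT NEAR-POINT CUT of the singular-surface leaf 32260** (modulo the two COSTUME ports):
`SingularSurfaceHuggingTowersTerminate n ⟺ (α) ∧ (β1) ∧ (β2)`. Sufficiency: realise, stabilise `H` (PROVED), run the
directrix dichotomy (PROVED); on the `e ≡ 2` branch either quasi-isolation holds on a tail or it fails infinitely
often, and then the ledger puts the tower in near-line normal form (PROVED). [folklore] -/
theorem singularSurface_iff_pieces {n : ℕ} (hR : Realisation n) (hL : LineagePort n) :
    SingularSurfaceHuggingTowersTerminate n ↔
      DirectrixOneTowersTerminate n ∧ QuasiIsolatedTowersTerminate n ∧ NearLineTowersTerminate n := by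
  refine ⟨fun h => ⟨(pieces_of_singularSurface h).1, (pieces_of_singularSurface h).2.1,
    (pieces_of_singularSurface h).2.2.1⟩, ?_⟩
  rintro ⟨h₁, h₂, h₃⟩ p hp k _ _ T g hB hD hE hS
  obtain ⟨R⟩ := hR p hp k T g hB hD hE hS
  obtain ⟨a, hst⟩ := R.exists_stableFrom
  rcases R.dichotomy hst with ⟨b, hab, hb⟩ | h2
  · exact h₁ p hp k T g hB hD hE ⟨hS, R, b, R.stableFrom_mono hst hab, hb⟩
  · by_cases hq : ∃ b, a ≤ b ∧ R.QIFrom b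
    · obtain ⟨b, hab, hb⟩ := hq
      exact h₂ p hp k T g hB hD hE ⟨hS, R, b, R.stableFrom_mono hst hab, R.dirTwoFrom_mono h2 hab, hb⟩
    · have hnq : R.NonQIRecurrent := by
        intro b
        by_contra hc
        push Not at hc
        exact hq ⟨max a b, le_max_left _ _, fun i hi => hc i (le_trans (le_max_right _ _) hi)⟩
      obtain ⟨L⟩ := hL p hp k T g hB hD hE hS R a hst
      exact h₃ p hp k T g hB hD hE ⟨hS, R, a, hst, h2, L.nearLineRecurrent_of_nonQI hnq⟩

/-- **KERNEL — THE TARGET LEAF FROM THE RESIDUAL ALONE, modulo the ports and the two CJS engines BY NAME.**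
(Sources: CossartJannsenSaito2020, Cor. 6.37, Thm. 6.40.) -/
theorem singularSurface_of_g13 {n : ℕ} (hR : Realisation n) (hL : LineagePort n) (h640 : KeyTheorem640_char.{0})
    (h637 : Corollary637_char.{0}) (hA : DirOneAdapter) (hRs : Restart) (hI : IsolationPort n)
    (hN : NearLineTowersTerminate n) : SingularSurfaceHuggingTowersTerminate n :=
  (singularSurface_iff_pieces hR hL).2
    ⟨directrixOne_of_corollary637 h637 hA hRs hI, quasiIsolated_of_keyTheorem640 h640 n, hN⟩

/-- The same with the residual in RAW form. [folklore] -/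
theorem singularSurface_of_g13' {n : ℕ} (hR : Realisation n) (hL : LineagePort n) (h640 : KeyTheorem640_char.{0})
    (h637 : Corollary637_char.{0}) (hA : DirOneAdapter) (hRs : Restart) (hI : IsolationPort n)
    (hN : NonQuasiIsolatedTowersTerminate n) : SingularSurfaceHuggingTowersTerminate n :=
  singularSurface_of_g13 hR hL h640 h637 hA hRs hI ((nearLine_iff_nonQuasiIsolated hL).2 hN)


end Summit.ResolutionOfSingularities.ResolutionOfSingularities.Theorems.NearPointCut
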